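import Literature.Computability.AlgebraicComplexity.BorderApolarityCandidates
import HarnessLib

/-!
# `14 ≤ bR(⟨2,3,3⟩)`, local part: the `(210)`/`(120)` test dimensions of the torus-fixed
# candidates, bounded by kernel-checked triangular rank certificates

Topic `Literature/Computability/AlgebraicComplexity`. Second half of the elementary proof of the
lower bound in Conner–Harper–Landsberg 2023, Thm. 1.4(1) (`R̲(M_⟨233⟩) = 14`; proof in §7.3 of
arXiv:1911.07981: `u = w = 3`, `v = 2`, candidates `E_{110} = M(C^*) ⊕ E'`, `E' ⊆ U^* ⊗ 𝔰𝔩(V) ⊗ W`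
a `4`-plane, "none of them pass the `(210)` and `(120)` tests"). In the tree's coordinates
(`matMulTensor K 2 3 3`, index types `ι = κ = Fin 2 × Fin 3`) a torus-fixed candidate is
`M ⊕ span S` for a set `S` of weight vectors of types `H, R, L`, and its `(210)`-test space splits
along the spectator index `j` (and the `(120)`-test along `k`) into LOCAL test spaces
`testI (ElocI A)` (`testK (ElocK A)`), `A` a set of at most `4` local weight vectors. This file
defines the local data and proves the dimension bounds the global argument
(`BorderRank233.lean`) consumes:

* `BR233.blocI`, `BR233.ElocI A` — the local weight vectors (`m_k = e_{(0,k),0} + e_{(1,k),1}`,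
  `H_k = e_{(0,k),0} − e_{(1,k),1}`, `R_k = e_{(0,k),1}`, `L_k = e_{(1,k),0}`) and the local
  candidate `span (m_0, m_1, m_2, A)`; `BR233.blocK`, `BR233.ElocK` likewise.
* `BR233.finrank_testI_ElocI_le` — `dim testI (ElocI A) + 18 + |cert| ≤ 6 · (3 + |A|)` for every
  list `cert` of (vector, pivot) pairs passing the Boolean triangularity check `triCheckI`
  (run by the kernel on integers): rank–nullity for the skew-symmetrisation on `A ⊗ ElocI A`
  (`finrank_testI_add`), the `18` skew-images of the `m`-part are independent (a fixed triangular
  certificate), and modulo them (an explicit projection `piI` with `12` coordinates killing the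
  `m`-part) the listed skew-images are independent (`linearIndependent_of_triangular`).
  `BR233.finrank_testK_ElocK_le` likewise.

The certificates themselves (one per local set `A` with `|A| ≤ 3`, found by a search outside Lean
and merely CHECKED here) and the universal local bounds are in `BorderRank233LocalCerts.lean`.
CHL obtain the corresponding ranks by hand from the representation theory of `GL(U) × GL(V) ×
GL(W)` (§7, Prop. 7.1, Rem. 7.2) for the nine Borel-fixed candidates; the tree checks all
torus-fixed ones instead (no Borel fixed point theorem is available), which is why the local
bookkeeping is heavier than in the source.

## References

* A. Conner, A. Harper, J. M. Landsberg, *New lower bounds for matrix multiplication and `det₃`*,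
  Forum Math. Pi 11 (2023) e17, arXiv:1911.07981 — Thm. 1.4(1) and its proof, §7.3; Prop. 7.1.
  [ConnerHarperLandsberg2023]
-/

namespace Literature.Computability.AlgebraicComplexity

namespace BR233

open BorderApolarity

/-- `ι = κ = Fin 2 × Fin 3` (an element `(i, k)` of `ι` indexes the output entry `z_{ik}`, an
element `(i', j)` of `κ` the entry `x_{i'j}`). [cite: ConnerHarperLandsberg2023, §7.3] -/
abbrev I6 := Fin 2 × Fin 3

/-- Local `(210)`-side coordinates `((i,k), i')` (the spectator `j` dropped).
[cite: ConnerHarperLandsberg2023, §7.3] -/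
abbrev LocI := I6 × Fin 2

/-- Local `(120)`-side coordinates `(i, (i',j))` (the spectator `k` dropped).
[cite: ConnerHarperLandsberg2023, §7.3] -/
abbrev LocK := Fin 2 × I6

/-- Coordinates of the local `(210)`-test space `A ⊗ A ⊗ V^*`. [cite: ConnerHarperLandsberg2023, §7.3] -/
abbrev CI := I6 × I6 × Fin 2

/-- Coordinates of the local `(120)`-test space `V ⊗ B ⊗ B`. [cite: ConnerHarperLandsberg2023, §7.3] -/
abbrev CK := Fin 2 × I6 × I6

section Ring

variable {R : Type*} [CommRing R]

/-! ## Local weight vectors -/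

/-- The local weight vector attached to a local coordinate `c = ((i,k),i')`: type `m`
(`i = i' = 0`): `e_{(0,k),0} + e_{(1,k),1}`; type `R` (`i = 0, i' = 1`): `e_{(0,k),1}`; type `L`
(`i = 1, i' = 0`): `e_{(1,k),0}`; type `H` (`i = i' = 1`): `e_{(0,k),0} − e_{(1,k),1}` — the
`j`-slices of `M(C^*)` and of CHL's weight vectors `x^i_2 y^1_k`, `x^i_1 y^2_k`,
`x^i_1 y^1_k − x^i_2 y^2_k` of `U^* ⊗ 𝔰𝔩(V) ⊗ W`. [cite: ConnerHarperLandsberg2023, §7.3] -/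
def blocI (c : LocI) : LocI → R := fun d =>
  if c.1.1 = 0 then
    (if c.2 = 0 then
      (if d = ((0, c.1.2), 0) then 1 else 0) + (if d = ((1, c.1.2), 1) then 1 else 0)
     else (if d = ((0, c.1.2), 1) then 1 else 0))
  else
    (if c.2 = 0 then (if d = ((1, c.1.2), 0) then 1 else 0)
     else (if d = ((0, c.1.2), 0) then 1 else 0) - (if d = ((1, c.1.2), 1) then 1 else 0))

/-- The `(120)`-side local weight vector attached to `c = (i, (i',j))` (same four types, the
`k`-slices). [cite: ConnerHarperLandsberg2023, §7.3] -/
def blocK (c : LocK) : LocK → R := fun d =>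
  if c.1 = 0 then
    (if c.2.1 = 0 then
      (if d = (0, (0, c.2.2)) then 1 else 0) + (if d = (1, (1, c.2.2)) then 1 else 0)
     else (if d = (0, (1, c.2.2)) then 1 else 0))
  else
    (if c.2.1 = 0 then (if d = (1, (0, c.2.2)) then 1 else 0)
     else (if d = (0, (0, c.2.2)) then 1 else 0) - (if d = (1, (1, c.2.2)) then 1 else 0))

/-- `e_{a₀} ⊗ g ∈ A ⊗ (A ⊗ V^*)` in coordinates. [folklore] -/
def tensI (a₀ : I6) (g : LocI → R) : CI → R := fun s => if s.1 = a₀ then g (s.2.1, s.2.2) else 0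

/-- `g ⊗ e_{b₁} ∈ (V ⊗ B) ⊗ B` in coordinates. [folklore] -/
def tensK (g : LocK → R) (b₁ : I6) : CK → R := fun s => if s.2.2 = b₁ then g (s.1, s.2.1) else 0

/-- Skew-symmetrisation in the two `ι` slots (the function underlying `skewIL`). [folklore] -/
def skewIf (y : CI → R) : CI → R := fun s => y s - y (s.2.1, s.1, s.2.2)

/-- Skew-symmetrisation in the two `κ` slots (the function underlying `skewKL`). [folklore] -/
def skewKf (z : CK → R) : CK → R := fun s => z s - z (s.1, s.2.2, s.2.1)

/-- The `12` coordinates of the projection `π_I` killing the skew-images of the `m`-part of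
`A ⊗ ElocI A` (found by linear algebra outside Lean; that it kills them is re-checked below), as a
list. [folklore] -/
def piIList (y : CI → R) : List R :=
  [y ((0,0),(0,1),1), y ((0,0),(0,2),1), y ((0,1),(0,2),1),
   y ((0,0),(0,1),0) - y ((0,0),(1,1),1) + y ((0,1),(1,0),1),
   y ((0,0),(0,2),0) - y ((0,0),(1,2),1) + y ((0,2),(1,0),1),
   y ((0,1),(0,2),0) - y ((0,1),(1,2),1) + y ((0,2),(1,1),1),
   y ((1,0),(1,1),0),
   - y ((0,0),(1,1),0) + y ((0,1),(1,0),0) + y ((1,0),(1,1),1),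
   y ((1,0),(1,2),0),
   - y ((0,0),(1,2),0) + y ((0,2),(1,0),0) + y ((1,0),(1,2),1),
   y ((1,1),(1,2),0),
   - y ((0,1),(1,2),0) + y ((0,2),(1,1),0) + y ((1,1),(1,2),1)]

/-- The projection `π_I : K^{CI} → K^{12}`. [folklore] -/
def piI (y : CI → R) : Fin 12 → R := fun r => (piIList y).getD r.val 0

/-- The `12` coordinates of the projection `π_K` killing the skew-images of the `m`-part of
`ElocK A ⊗ B`, as a list. [folklore] -/
def piKList (z : CK → R) : List R :=
  [z (0,(1,0),(1,1)), z (0,(1,0),(1,2)), z (0,(1,1),(1,2)),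
   z (1,(0,0),(0,1)), z (1,(0,0),(0,2)), z (1,(0,1),(0,2)),
   z (0,(0,0),(0,1)) - z (1,(0,0),(1,1)) + z (1,(0,1),(1,0)),
   z (0,(0,0),(0,2)) - z (1,(0,0),(1,2)) + z (1,(0,2),(1,0)),
   z (0,(0,1),(0,2)) - z (1,(0,1),(1,2)) + z (1,(0,2),(1,1)),
   - z (0,(0,0),(1,1)) + z (0,(0,1),(1,0)) + z (1,(1,0),(1,1)),
   - z (0,(0,0),(1,2)) + z (0,(0,2),(1,0)) + z (1,(1,0),(1,2)),
   - z (0,(0,1),(1,2)) + z (0,(0,2),(1,1)) + z (1,(1,1),(1,2))]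

/-- The projection `π_K : K^{CK} → K^{12}`. [folklore] -/
def piK (z : CK → R) : Fin 12 → R := fun r => (piKList z).getD r.val 0

/-- The skew-image of `e_{a₀} ⊗ blocI c`. [folklore] -/
def sI (a₀ : I6) (c : LocI) : CI → R := skewIf (tensI a₀ (blocI c))

/-- The skew-image of `blocK c ⊗ e_{b₁}`. [folklore] -/
def sK (c : LocK) (b₁ : I6) : CK → R := skewKf (tensK (blocK c) b₁)

/-- `w_{a₀,c} = π_I(skew(e_{a₀} ⊗ blocI c)) ∈ R^{12}`. [folklore] -/
def wI (a₀ : I6) (c : LocI) : Fin 12 → R := piI (sI a₀ c)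

/-- `w'_{c,b₁} = π_K(skew(blocK c ⊗ e_{b₁})) ∈ R^{12}`. [folklore] -/
def wK (c : LocK) (b₁ : I6) : Fin 12 → R := piK (sK c b₁)

/-! ### Naturality under ring homomorphisms (integers to the field) -/

variable {S : Type*} [CommRing S] (f : R →+* S)

omit [CommRing R] [CommRing S] in
/-- `blocI` is preserved by ring homomorphisms. [folklore] -/
theorem map_blocI {R S : Type*} [CommRing R] [CommRing S] (f : R →+* S) (c d : LocI) :
    f (blocI c d) = blocI c d := by
  simp only [blocI, apply_ite f, map_add, map_sub, map_one, map_zero]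

omit [CommRing R] [CommRing S] in
/-- `blocK` is preserved by ring homomorphisms. [folklore] -/
theorem map_blocK {R S : Type*} [CommRing R] [CommRing S] (f : R →+* S) (c d : LocK) :
    f (blocK c d) = blocK c d := by
  simp only [blocK, apply_ite f, map_add, map_sub, map_one, map_zero]

/-- `sI` is preserved by ring homomorphisms. [folklore] -/
theorem map_sI (a₀ : I6) (c : LocI) (s : CI) : f (sI a₀ c s) = sI a₀ c s := by
  simp only [sI, skewIf, tensI, map_sub, apply_ite f, map_blocI, map_zero]

/-- `sK` is preserved by ring homomorphisms. [folklore] -/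
theorem map_sK (c : LocK) (b₁ : I6) (s : CK) : f (sK c b₁ s) = sK c b₁ s := by
  simp only [sK, skewKf, tensK, map_sub, apply_ite f, map_blocK, map_zero]

/-- `piI` is preserved by ring homomorphisms. [folklore] -/
theorem map_piI (y : CI → R) (r : Fin 12) : f (piI y r) = piI (fun s => f (y s)) r := by
  fin_cases r <;> simp [piI, piIList]

/-- `piK` is preserved by ring homomorphisms. [folklore] -/
theorem map_piK (z : CK → R) (r : Fin 12) : f (piK z r) = piK (fun s => f (z s)) r := by
  fin_cases r <;> simp [piK, piKList]

/-- `wI` is preserved by ring homomorphisms. [folklore] -/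
theorem map_wI (a₀ : I6) (c : LocI) (r : Fin 12) : f (wI a₀ c r) = wI a₀ c r := by
  rw [wI, map_piI]
  simp only [map_sI]
  rfl

/-- `wK` is preserved by ring homomorphisms. [folklore] -/
theorem map_wK (c : LocK) (b₁ : I6) (r : Fin 12) : f (wK c b₁ r) = wK c b₁ r := by
  rw [wK, map_piK]
  simp only [map_sK]
  rfl

end Ring

/-! ## The Boolean certificate checks (run by the kernel on integers) -/

/-- Generic triangularity check of a list of (label, pivot) pairs against an integer-valued
evaluation `val`: the vector of each label is nonzero at its pivot and the vectors of all LATER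
labels vanish there. [folklore] -/
def triChk {α X : Type} (val : α → X → ℤ) : List (α × X) → Bool
  | [] => true
  | e :: rest => (val e.1 e.2 != 0) && rest.all (fun e' => val e'.1 e.2 == 0) && triChk val rest

/-- What `triChk` checks, as propositions on indices. [folklore] -/
theorem triChk_spec {α X : Type} (val : α → X → ℤ) :
    ∀ l : List (α × X), triChk val l = true →
      (∀ (n : ℕ) (hn : n < l.length), val (l[n]).1 (l[n]).2 ≠ 0) ∧
      (∀ (n m : ℕ) (hn : n < l.length) (hm : m < l.length), n < m → val (l[m]).1 (l[n]).2 = 0)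
  | [], _ => by simp
  | e :: rest, h => by
    simp only [triChk, Bool.and_eq_true, bne_iff_ne, ne_eq, List.all_eq_true, beq_iff_eq] at h
    obtain ⟨⟨h1, h2⟩, h3⟩ := h
    obtain ⟨ih1, ih2⟩ := triChk_spec val rest h3
    refine ⟨fun n hn => ?_, fun n m hn hm hnm => ?_⟩
    · rcases n with _ | n
      · simpa using h1
      · simp only [List.getElem_cons_succ]
        exact ih1 n (by simpa using hn)
    · rcases n with _ | n
      · rcases m with _ | m
        · omega
        · simp only [List.getElem_cons_succ, List.getElem_cons_zero]
          exact h2 _ (List.getElem_mem _)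
      · rcases m with _ | m
        · omega
        · simp only [List.getElem_cons_succ]
          exact ih2 n m (by simpa using hn) (by simpa using hm) (by omega)

/-- Evaluation for the `(210)`-side certificates: `((a₀, c), r) ↦ w_{a₀,c}(r)`. [folklore] -/
def valI (p : I6 × LocI) (r : Fin 12) : ℤ := wI p.1 p.2 r

/-- Evaluation for the `(120)`-side certificates: `((c, b₁), r) ↦ w'_{c,b₁}(r)`. [folklore] -/
def valK (p : LocK × I6) (r : Fin 12) : ℤ := wK p.1 p.2 r

/-- The three `m`-type local coordinates on the `(210)` side, `((0,k),0)`. [folklore] -/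
def mI (k : Fin 3) : LocI := ((0, k), 0)

/-- The three `m`-type local coordinates on the `(120)` side, `(0,(0,j))`. [folklore] -/
def mK (j : Fin 3) : LocK := (0, (0, j))

/-- Triangular certificate for the `18` skew-images `skew(e_{a₀} ⊗ m_k)`: (vector `(a₀,k)`,
pivot coordinate). [folklore] -/
def mCertI : List ((I6 × Fin 3) × CI) :=
  [(((1,0),0), ((0,0),(1,0),0)), (((0,0),0), ((0,0),(1,0),1)), (((1,1),0), ((0,0),(1,1),0)),
   (((0,0),1), ((0,0),(1,1),1)), (((0,1),0), ((0,0),(0,1),0)), (((1,2),0), ((0,0),(1,2),0)),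
   (((0,0),2), ((0,0),(1,2),1)), (((0,2),0), ((0,0),(0,2),0)), (((1,0),1), ((0,1),(1,0),0)),
   (((1,1),1), ((0,1),(1,1),0)), (((0,1),1), ((0,1),(1,1),1)), (((1,2),1), ((0,1),(1,2),0)),
   (((0,1),2), ((0,1),(1,2),1)), (((0,2),1), ((0,1),(0,2),0)), (((1,0),2), ((0,2),(1,0),0)),
   (((1,1),2), ((0,2),(1,1),0)), (((1,2),2), ((0,2),(1,2),0)), (((0,2),2), ((0,2),(1,2),1))]

/-- Triangular certificate for the `18` skew-images `skew(m_j ⊗ e_{b₁})`. [folklore] -/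
def mCertK : List ((Fin 3 × I6) × CK) :=
  [((0,(1,0)), (0,(0,0),(1,0))), ((0,(1,1)), (0,(0,0),(1,1))), ((0,(1,2)), (0,(0,0),(1,2))),
   ((1,(1,0)), (0,(0,1),(1,0))), ((1,(1,1)), (0,(0,1),(1,1))), ((1,(1,2)), (0,(0,1),(1,2))),
   ((2,(1,0)), (0,(0,2),(1,0))), ((2,(1,1)), (0,(0,2),(1,1))), ((2,(1,2)), (0,(0,2),(1,2))),
   ((0,(0,0)), (1,(0,0),(1,0))), ((1,(0,0)), (1,(0,0),(1,1))), ((0,(0,1)), (0,(0,0),(0,1))),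
   ((2,(0,0)), (1,(0,0),(1,2))), ((0,(0,2)), (0,(0,0),(0,2))), ((1,(0,1)), (1,(0,1),(1,1))),
   ((2,(0,1)), (1,(0,1),(1,2))), ((1,(0,2)), (0,(0,1),(0,2))), ((2,(0,2)), (1,(0,2),(1,2)))]

/-- Evaluation for the `m`-part certificate on the `(210)` side: `((a₀,k), s) ↦ skew(e_{a₀} ⊗ m_k)(s)`.
[folklore] -/
def valMI (p : I6 × Fin 3) (s : CI) : ℤ := sI p.1 (mI p.2) s

/-- Evaluation for the `m`-part certificate on the `(120)` side. [folklore] -/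
def valMK (p : Fin 3 × I6) (s : CK) : ℤ := sK (mK p.1) p.2 s

/-- The `m`-part certificate passes (kernel computation). [folklore] -/
theorem triChk_mCertI : triChk valMI mCertI = true := by decide +kernel

/-- The `m`-part certificate passes (kernel computation). [folklore] -/
theorem triChk_mCertK : triChk valMK mCertK = true := by decide +kernel

/-- `mCertI` has `18` entries. [folklore] -/
theorem length_mCertI : mCertI.length = 18 := rfl

/-- `mCertK` has `18` entries. [folklore] -/
theorem length_mCertK : mCertK.length = 18 := rfl

/-- `mCertI` lists all `18` pairs `(a₀, k)`. [folklore] -/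
theorem mCertI_complete : ∀ p : I6 × Fin 3, p ∈ mCertI.map Prod.fst := by decide

/-- `mCertK` lists all `18` pairs `(j, b₁)`. [folklore] -/
theorem mCertK_complete : ∀ p : Fin 3 × I6, p ∈ mCertK.map Prod.fst := by decide

/-- `π_I` kills the skew-images of the `m`-part (kernel computation on integers). [folklore] -/
theorem piI_sI_mI_int : ∀ (a₀ : I6) (k : Fin 3) (r : Fin 12), piI (sI (R := ℤ) a₀ (mI k)) r = 0 := by
  decide +kernel

/-- `π_K` kills the skew-images of the `m`-part (kernel computation on integers). [folklore] -/
theorem piK_sK_mK_int : ∀ (j : Fin 3) (b₁ : I6) (r : Fin 12), piK (sK (R := ℤ) (mK j) b₁) r = 0 := by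
  decide +kernel


/-! ## Over a field of characteristic zero: the local candidates and the dimension bounds -/

section Field

universe u

variable {K : Type u} [Field K] [CharZero K]

/-- Independence from a passed triangularity check, over any field of characteristic `0`.
[folklore] -/
theorem linearIndependent_of_triChk {α X : Type} (val : α → X → ℤ) (l : List (α × X))
    (h : triChk val l = true) :
    LinearIndependent K (fun t : Fin l.length => fun x : X => ((val (l[(t : ℕ)]).1 x : ℤ) : K)) := by
  obtain ⟨h1, h2⟩ := triChk_spec val l h
  refine linearIndependent_of_triangular _ (fun t => (l[(t : ℕ)]).2) (fun t => ?_) (fun s t hst => ?_)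
  · exact_mod_cast h1 t t.2
  · have := h2 t s t.2 s.2 hst
    exact_mod_cast this

/-- The generators of the local `(210)` candidate: the three `m_k` and the elements of `A`. [folklore] -/
def genI (A : Finset LocI) : Finset LocI := Finset.univ.image mI ∪ A

/-- The generators of the local `(120)` candidate. [folklore] -/
def genK (A : Finset LocK) : Finset LocK := Finset.univ.image mK ∪ A

omit [CharZero K] in
/-- `|genI A| ≤ 3 + |A|`. [folklore] -/
theorem card_genI_le (A : Finset LocI) : (genI A).card ≤ 3 + A.card :=
  (Finset.card_union_le _ _).trans (Nat.add_le_add_right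
    (Finset.card_image_le.trans (by simp)) _)

omit [CharZero K] in
/-- `|genK A| ≤ 3 + |A|`. [folklore] -/
theorem card_genK_le (A : Finset LocK) : (genK A).card ≤ 3 + A.card :=
  (Finset.card_union_le _ _).trans (Nat.add_le_add_right
    (Finset.card_image_le.trans (by simp)) _)

variable (K) in
/-- **The local `(210)` candidate** `ElocI A = span(m_0, m_1, m_2, A) ⊆ K^{LocI}` — the `j`-slice of
a torus-fixed candidate `M(C^*) ⊕ span S`. [cite: ConnerHarperLandsberg2023, §7.3] -/
def ElocI (A : Finset LocI) : Submodule K (LocI → K) :=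
  Submodule.span K (Set.range fun c : ↥(genI A) => (blocI (R := K) c.1))

variable (K) in
/-- **The local `(120)` candidate** `ElocK A = span(m_0, m_1, m_2, A) ⊆ K^{LocK}`.
[cite: ConnerHarperLandsberg2023, §7.3] -/
def ElocK (A : Finset LocK) : Submodule K (LocK → K) :=
  Submodule.span K (Set.range fun c : ↥(genK A) => (blocK (R := K) c.1))

omit [CharZero K] in
/-- `dim ElocI A ≤ 3 + |A|`. [folklore] -/
theorem finrank_ElocI_le (A : Finset LocI) : Module.finrank K (ElocI K A) ≤ 3 + A.card :=
  (finrank_range_le_card _).trans (by rw [Fintype.card_coe]; exact card_genI_le A)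

omit [CharZero K] in
/-- `dim ElocK A ≤ 3 + |A|`. [folklore] -/
theorem finrank_ElocK_le (A : Finset LocK) : Module.finrank K (ElocK K A) ≤ 3 + A.card :=
  (finrank_range_le_card _).trans (by rw [Fintype.card_coe]; exact card_genK_le A)

omit [CharZero K] in
/-- Generators lie in the local candidate. [folklore] -/
theorem blocI_mem_ElocI {A : Finset LocI} {c : LocI} (hc : c ∈ genI A) :
    (blocI (R := K) c) ∈ ElocI K A :=
  Submodule.subset_span ⟨⟨c, hc⟩, rfl⟩

omit [CharZero K] in
/-- Generators lie in the local candidate. [folklore] -/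
theorem blocK_mem_ElocK {A : Finset LocK} {c : LocK} (hc : c ∈ genK A) :
    (blocK (R := K) c) ∈ ElocK K A :=
  Submodule.subset_span ⟨⟨c, hc⟩, rfl⟩

omit [CharZero K] in
/-- The `m_k` are generators. [folklore] -/
theorem mI_mem_genI (A : Finset LocI) (k : Fin 3) : mI k ∈ genI A :=
  Finset.mem_union_left _ (Finset.mem_image_of_mem _ (Finset.mem_univ k))

omit [CharZero K] in
/-- The `m_j` are generators. [folklore] -/
theorem mK_mem_genK (A : Finset LocK) (j : Fin 3) : mK j ∈ genK A :=
  Finset.mem_union_left _ (Finset.mem_image_of_mem _ (Finset.mem_univ j))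

omit [CharZero K] in
/-- `e_{a₀} ⊗ g ∈ A ⊗ E` when `g ∈ E`. [folklore] -/
theorem tensI_mem_slicesI {E : Submodule K (LocI → K)} {g : LocI → K} (hg : g ∈ E) (a₀ : I6) :
    tensI a₀ g ∈ slicesI E := by
  refine mem_slicesI.2 fun x => ?_
  by_cases hx : x = a₀
  · have : sliceI x (tensI a₀ g) = g := funext fun ab => by simp [tensI, hx]
    rw [this]; exact hg
  · have : sliceI x (tensI a₀ g) = 0 := funext fun ab => by simp [tensI, hx]
    rw [this]; exact Submodule.zero_mem _

omit [CharZero K] in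
/-- `g ⊗ e_{b₁} ∈ E ⊗ B` when `g ∈ E`. [folklore] -/
theorem tensK_mem_slicesK {E : Submodule K (LocK → K)} {g : LocK → K} (hg : g ∈ E) (b₁ : I6) :
    tensK g b₁ ∈ slicesK E := by
  refine mem_slicesK.2 fun x => ?_
  by_cases hx : x = b₁
  · have : sliceK x (tensK g b₁) = g := funext fun ab => by simp [tensK, hx]
    rw [this]; exact hg
  · have : sliceK x (tensK g b₁) = 0 := funext fun ab => by simp [tensK, hx]
    rw [this]; exact Submodule.zero_mem _

/-- `π_I` as a linear map. [folklore] -/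
def piIL : (CI → K) →ₗ[K] (Fin 12 → K) where
  toFun := piI
  map_add' x y := by
    funext r
    fin_cases r <;> simp [piI, piIList] <;> ring
  map_smul' c x := by
    funext r
    fin_cases r <;> simp [piI, piIList] <;> ring

/-- `π_K` as a linear map. [folklore] -/
def piKL : (CK → K) →ₗ[K] (Fin 12 → K) where
  toFun := piK
  map_add' x y := by
    funext r
    fin_cases r <;> simp [piK, piKList] <;> ring
  map_smul' c x := by
    funext r
    fin_cases r <;> simp [piK, piKList] <;> ring

omit [CharZero K] in
/-- Integer and field versions of `sI` agree. [folklore] -/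
theorem sI_cast (a₀ : I6) (c : LocI) (s : CI) : ((sI (R := ℤ) a₀ c s : ℤ) : K) = sI (R := K) a₀ c s :=
  map_sI (Int.castRingHom K) a₀ c s

omit [CharZero K] in
/-- Integer and field versions of `sK` agree. [folklore] -/
theorem sK_cast (c : LocK) (b₁ : I6) (s : CK) : ((sK (R := ℤ) c b₁ s : ℤ) : K) = sK (R := K) c b₁ s :=
  map_sK (Int.castRingHom K) c b₁ s

omit [CharZero K] in
/-- Integer and field versions of `wI` agree. [folklore] -/
theorem wI_cast (a₀ : I6) (c : LocI) (r : Fin 12) : ((wI (R := ℤ) a₀ c r : ℤ) : K) = wI (R := K) a₀ c r :=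
  map_wI (Int.castRingHom K) a₀ c r

omit [CharZero K] in
/-- Integer and field versions of `wK` agree. [folklore] -/
theorem wK_cast (c : LocK) (b₁ : I6) (r : Fin 12) : ((wK (R := ℤ) c b₁ r : ℤ) : K) = wK (R := K) c b₁ r :=
  map_wK (Int.castRingHom K) c b₁ r

omit [CharZero K] in
/-- `π_I(skew(e_{a₀} ⊗ m_k)) = 0` over the field. [folklore] -/
theorem piIL_sI_mI (a₀ : I6) (k : Fin 3) : piIL (K := K) (sI (R := K) a₀ (mI k)) = 0 := by
  funext r
  change piI (sI (R := K) a₀ (mI k)) r = 0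
  have h1 : (fun s => ((sI (R := ℤ) a₀ (mI k) s : ℤ) : K)) = sI (R := K) a₀ (mI k) :=
    funext fun s => sI_cast a₀ (mI k) s
  have h2 : piI (fun s => ((sI (R := ℤ) a₀ (mI k) s : ℤ) : K)) r =
      ((piI (sI (R := ℤ) a₀ (mI k)) r : ℤ) : K) := (map_piI (Int.castRingHom K) _ r).symm
  rw [← h1, h2, piI_sI_mI_int a₀ k r, Int.cast_zero]

omit [CharZero K] in
/-- `π_K(skew(m_j ⊗ e_{b₁})) = 0` over the field. [folklore] -/
theorem piKL_sK_mK (j : Fin 3) (b₁ : I6) : piKL (K := K) (sK (R := K) (mK j) b₁) = 0 := by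
  funext r
  change piK (sK (R := K) (mK j) b₁) r = 0
  have h1 : (fun s => ((sK (R := ℤ) (mK j) b₁ s : ℤ) : K)) = sK (R := K) (mK j) b₁ :=
    funext fun s => sK_cast (mK j) b₁ s
  have h2 : piK (fun s => ((sK (R := ℤ) (mK j) b₁ s : ℤ) : K)) r =
      ((piK (sK (R := ℤ) (mK j) b₁) r : ℤ) : K) := (map_piK (Int.castRingHom K) _ r).symm
  rw [← h1, h2, piK_sK_mK_int j b₁ r, Int.cast_zero]

/-- **Local `(210)` dimension bound from a certificate.** For every list `cert` of pairs
`((a₀, c), r)` with `c` a generator of `ElocI A` that passes `triChk valI`: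
`dim testI (ElocI A) + 18 + |cert| ≤ 6 · (3 + |A|)`. [cite: ConnerHarperLandsberg2023, §7.3 (the
(210)-test ranks)] -/
theorem finrank_testI_ElocI_le (A : Finset LocI) (cert : List ((I6 × LocI) × Fin 12))
    (hA : ∀ e ∈ cert, e.1.2 ∈ genI A) (hc : triChk valI cert = true) :
    Module.finrank K (testI (ElocI K A)) + 18 + cert.length ≤ 6 * (3 + A.card) := by
  have hrn := finrank_testI_add (K := K) (ElocI K A)
  have hV : Module.finrank K (slicesI (ElocI K A)) ≤ 6 * (3 + A.card) := by
    rw [finrank_slicesI]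
    have h6 : Fintype.card I6 = 6 := by simp
    rw [h6]
    exact Nat.mul_le_mul_left 6 (finrank_ElocI_le A)
  -- the m-part `X` and the certificate part `Y`
  let X : Submodule K (CI → K) :=
    Submodule.span K (Set.range fun p : I6 × Fin 3 => sI (R := K) p.1 (mI p.2))
  let Y : Submodule K (CI → K) :=
    Submodule.span K (Set.range fun t : Fin cert.length => sI (R := K) (cert[(t : ℕ)]).1.1 (cert[(t : ℕ)]).1.2)
  have hsk : ∀ (a₀ : I6) (c : LocI), c ∈ genI A →
      sI (R := K) a₀ c ∈ (slicesI (ElocI K A)).map (skewIL (K := K)) := fun a₀ c hcg =>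
    ⟨tensI a₀ (blocI (R := K) c), tensI_mem_slicesI (blocI_mem_ElocI hcg) a₀, rfl⟩
  have hXY : X ⊔ Y ≤ (slicesI (ElocI K A)).map (skewIL (K := K)) := by
    refine sup_le (Submodule.span_le.2 ?_) (Submodule.span_le.2 ?_)
    · rintro _ ⟨p, rfl⟩
      exact hsk p.1 (mI p.2) (mI_mem_genI A p.2)
    · rintro _ ⟨t, rfl⟩
      exact hsk _ _ (hA _ (List.getElem_mem _))
  -- `dim X ≥ 18`
  have hX : 18 ≤ Module.finrank K X := by
    have hli := linearIndependent_of_triChk (K := K) valMI mCertI triChk_mCertI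
    rw [← length_mCertI]
    refine le_finrank_of_linearIndependent_mem hli X fun t => ?_
    have : (fun x : CI => ((valMI (mCertI[(t : ℕ)]).1 x : ℤ) : K)) =
        sI (R := K) (mCertI[(t : ℕ)]).1.1 (mI (mCertI[(t : ℕ)]).1.2) :=
      funext fun x => sI_cast _ _ x
    rw [this]
    exact Submodule.subset_span ⟨((mCertI[(t : ℕ)]).1.1, (mCertI[(t : ℕ)]).1.2), rfl⟩
  -- `π_I` kills `X`
  have hπX : ∀ x ∈ X, piIL (K := K) x = 0 := by
    intro x hx
    have : X ≤ LinearMap.ker (piIL (K := K)) := by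
      refine Submodule.span_le.2 ?_
      rintro _ ⟨p, rfl⟩
      exact piIL_sI_mI p.1 p.2
    exact this hx
  -- `dim π(Y) ≥ |cert|`
  have hY : cert.length ≤ Module.finrank K (Y.map (piIL (K := K))) := by
    have hli := linearIndependent_of_triChk (K := K) valI cert hc
    refine le_finrank_of_linearIndependent_mem hli _ fun t => ?_
    have : (fun x : Fin 12 => ((valI (cert[(t : ℕ)]).1 x : ℤ) : K)) =
        piIL (K := K) (sI (R := K) (cert[(t : ℕ)]).1.1 (cert[(t : ℕ)]).1.2) :=
      funext fun x => wI_cast _ _ x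
    rw [this]
    exact Submodule.mem_map_of_mem (Submodule.subset_span ⟨t, rfl⟩)
  have h1 := finrank_add_finrank_map_le X Y (piIL (K := K)) hπX
  have h3 : 18 + cert.length ≤
      Module.finrank K ((slicesI (ElocI K A)).map (skewIL (K := K))) :=
    calc 18 + cert.length ≤ Module.finrank K X + Module.finrank K (Y.map (piIL (K := K))) :=
          Nat.add_le_add hX hY
      _ ≤ Module.finrank K ↥(X ⊔ Y) := h1
      _ ≤ _ := Submodule.finrank_mono hXY
  omega

/-- **Local `(120)` dimension bound from a certificate.** [cite: ConnerHarperLandsberg2023, §7.3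
(the (120)-test ranks)] -/
theorem finrank_testK_ElocK_le (A : Finset LocK) (cert : List ((LocK × I6) × Fin 12))
    (hA : ∀ e ∈ cert, e.1.1 ∈ genK A) (hc : triChk valK cert = true) :
    Module.finrank K (testK (ElocK K A)) + 18 + cert.length ≤ 6 * (3 + A.card) := by
  have hrn := finrank_testK_add (K := K) (ElocK K A)
  have hV : Module.finrank K (slicesK (ElocK K A)) ≤ 6 * (3 + A.card) := by
    rw [finrank_slicesK]
    have h6 : Fintype.card I6 = 6 := by simp
    rw [h6]
    exact Nat.mul_le_mul_left 6 (finrank_ElocK_le A)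
  let X : Submodule K (CK → K) :=
    Submodule.span K (Set.range fun p : Fin 3 × I6 => sK (R := K) (mK p.1) p.2)
  let Y : Submodule K (CK → K) :=
    Submodule.span K (Set.range fun t : Fin cert.length => sK (R := K) (cert[(t : ℕ)]).1.1 (cert[(t : ℕ)]).1.2)
  have hsk : ∀ (c : LocK) (b₁ : I6), c ∈ genK A →
      sK (R := K) c b₁ ∈ (slicesK (ElocK K A)).map (skewKL (K := K)) := fun c b₁ hcg =>
    ⟨tensK (blocK (R := K) c) b₁, tensK_mem_slicesK (blocK_mem_ElocK hcg) b₁, rfl⟩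
  have hXY : X ⊔ Y ≤ (slicesK (ElocK K A)).map (skewKL (K := K)) := by
    refine sup_le (Submodule.span_le.2 ?_) (Submodule.span_le.2 ?_)
    · rintro _ ⟨p, rfl⟩
      exact hsk (mK p.1) p.2 (mK_mem_genK A p.1)
    · rintro _ ⟨t, rfl⟩
      exact hsk _ _ (hA _ (List.getElem_mem _))
  have hX : 18 ≤ Module.finrank K X := by
    have hli := linearIndependent_of_triChk (K := K) valMK mCertK triChk_mCertK
    rw [← length_mCertK]
    refine le_finrank_of_linearIndependent_mem hli X fun t => ?_
    have : (fun x : CK => ((valMK (mCertK[(t : ℕ)]).1 x : ℤ) : K)) =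
        sK (R := K) (mK (mCertK[(t : ℕ)]).1.1) (mCertK[(t : ℕ)]).1.2 :=
      funext fun x => sK_cast _ _ x
    rw [this]
    exact Submodule.subset_span ⟨((mCertK[(t : ℕ)]).1.1, (mCertK[(t : ℕ)]).1.2), rfl⟩
  have hπX : ∀ x ∈ X, piKL (K := K) x = 0 := by
    intro x hx
    have : X ≤ LinearMap.ker (piKL (K := K)) := by
      refine Submodule.span_le.2 ?_
      rintro _ ⟨p, rfl⟩
      exact piKL_sK_mK p.1 p.2
    exact this hx
  have hY : cert.length ≤ Module.finrank K (Y.map (piKL (K := K))) := by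
    have hli := linearIndependent_of_triChk (K := K) valK cert hc
    refine le_finrank_of_linearIndependent_mem hli _ fun t => ?_
    have : (fun x : Fin 12 => ((valK (cert[(t : ℕ)]).1 x : ℤ) : K)) =
        piKL (K := K) (sK (R := K) (cert[(t : ℕ)]).1.1 (cert[(t : ℕ)]).1.2) :=
      funext fun x => wK_cast _ _ x
    rw [this]
    exact Submodule.mem_map_of_mem (Submodule.subset_span ⟨t, rfl⟩)
  have h1 := finrank_add_finrank_map_le X Y (piKL (K := K)) hπX
  have h3 : 18 + cert.length ≤
      Module.finrank K ((slicesK (ElocK K A)).map (skewKL (K := K))) :=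
    calc 18 + cert.length ≤ Module.finrank K X + Module.finrank K (Y.map (piKL (K := K))) :=
          Nat.add_le_add hX hY
      _ ≤ Module.finrank K ↥(X ⊔ Y) := h1
      _ ≤ _ := Submodule.finrank_mono hXY
  omega

end Field

end BR233

end Literature.Computability.AlgebraicComplexity
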